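import Literature.NumberTheory.EllipticCurves.FormalGroupChartLimitLogEquivarianceProofs
import Literature.NumberTheory.EllipticCurves.PadicPointsFiltrationProofs
import HarnessLib

/-!
# The limit logarithm, IV: base change along isometric embeddings, and the `ℚ_p` case
# (identification with the tree's `WeierstrassCurve.padicLimitLog`)

`Proofs` file (theorems only, no definitions, no named facts) in topic
`NumberTheory/EllipticCurves`; continuation of `FormalGroupChartLimitLogProofs` (I) /
`FormalGroupChartLimitLogEquivarianceProofs` (II) / `FormalGroupChartLimitLogAdditiveProofs` (III).
Notation as there: a valued field `(K, w)`, a `w`-integral equation, `E₁ = kernel w V`,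
`z = Affine.Point.zCoord`, `p : ℕ` with `0 < |p| < 1`, the level `E⁽ᵖ⁾ = level w V |p|`, and functions
`ℓ` with (SPEC) `∀ Q ∈ E⁽ᵖ⁾ ∀ r, |ℓ(Q) − z(pʳ·Q)/pʳ| ≤ |p|^{r+1}`.

* `limitLog_map_of_val_eq` — **base change**: for an ISOMETRIC `E`-algebra map `ι : K → K'`
  between valued fields and the points of `X_K`, `X_{K'}` (`X` over `E`), any (SPEC)-logarithms
  `ℓ` on `K` and `ℓ'` on `K'` satisfy `ℓ'(ι P) = ι(ℓ P)` on `E⁽ᵖ⁾(X_K)` — the logarithm of a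
  `ℚ₃`-point computed in `K_w ⊇ ℚ₃` is its `ℚ₃`-logarithm (the compatibility SAT₀ uses to read
  `log_ω(N_{K_w/ℚ₃} P)` at the bottom);
* the **`ℚ_p` case** (`K = ℚ_[p]`, `w = NormedField.valuation = ‖·‖₊`, `X` `p`-integral and
  elliptic): `isIntegral_valuationInteger_of_isIntegral_padicInt` (the tree's hypothesis
  `X.IsIntegral ℤ_[p]` gives `w`-integrality), `mem_kernel_iff_isInReductionKernel` and
  `zCoord_eq_formalParameter` (the two renderings `FormalGroupChart.kernel` / `zCoord` and
  `WeierstrassCurve.IsInReductionKernel` / `formalParameter` of `FormalGroup.lean` agree),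
  `level_padic_eq_kernel` (`ℚ_p` is unramified: `E⁽ᵖ⁾ = E₁(ℚ_p)`), **`exists_limitLog_padic`**
  (a (SPEC)-logarithm on ALL of `E₁(ℚ_p)`, values in `pℤ_p`), and the identification with the
  tree's limit logarithm: **`limitLog_eq_padicLimitLog`** (`ℓ(Q) = X.padicLimitLog Q` when
  `‖z(Q)‖ < p⁻¹`, the domain where `PadicPointsFiltrationProofs` proves convergence) and
  **`limitLog_eq_padicLimitLog_smul_div`** (`ℓ(Q) = X.padicLimitLog (p·Q) / p` on all of
  `E₁(ℚ_p)`).  Through these, the `ℚ_p`-side lemmas of the tree stated with `padicLimitLog`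
  (`Additive/PadicLogImage`, `KimAtThreeFineKatoSATPoints*`) transfer to `ℓ`.

## References

* [SilvermanAEC2009] J. H. Silverman, *The Arithmetic of Elliptic Curves*, 2nd ed. (2009), IV.5–IV.6
  (Thm. IV.6.4), Prop. VII.2.2, Prop. VII.6.3.

## Design

No definitions; one universe `u` for `E`, `K`, `K'` in the base-change section (as in the layer
files).  `noncomputable section`, `open scoped Classical NNReal`; axioms standard.
-/

noncomputable section

open scoped Classical NNReal

namespace Literature.NumberTheory.EllipticCurves.FormalGroupChart

/-! ### Base change along an isometric embedding -/

section BaseChange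

universe u

variable {E : Type u} [Field E] {K K' : Type u} [Field K] [Field K'] [Algebra E K] [Algebra E K']
  {X : WeierstrassCurve E} {w : Valuation K ℝ≥0} {w' : Valuation K' ℝ≥0}
  [hV : (X.baseChange K).IsIntegral w.integer] [hV' : (X.baseChange K').IsIntegral w'.integer]

/-- An isometric embedding preserves and reflects the kernel of reduction (`|x| > 1`).
[cite: SilvermanAEC2009, Prop. VII.2.2] -/
theorem map_mem_kernel_iff_of_val_eq {ι : K →ₐ[E] K'} (hι : ∀ x, w' (ι x) = w x)
    (P : (X.baseChange K).toAffine.Point) :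
    WeierstrassCurve.Affine.Point.map ι P ∈ kernel w' (X.baseChange K') ↔
      P ∈ kernel w (X.baseChange K) := by
  rcases P with _ | ⟨x, y, h⟩
  · rw [← WeierstrassCurve.Affine.Point.zero_def, map_zero]
    exact ⟨fun _ ↦ (kernel w (X.baseChange K)).zero_mem, fun _ ↦ (kernel w' (X.baseChange K')).zero_mem⟩
  · rw [WeierstrassCurve.Affine.Point.map_some, some_mem_kernel_iff, some_mem_kernel_iff, hι]

/-- An isometric embedding maps the level `E⁽ᵖ⁾(X_K)` into `E⁽ᵖ⁾(X_{K'})`.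
[cite: SilvermanAEC2009, Prop. VII.2.2] -/
theorem map_mem_level_of_val_eq {ι : K →ₐ[E] K'} (hι : ∀ x, w' (ι x) = w x) {p : ℕ}
    {Q : (X.baseChange K).toAffine.Point} (hQ : Q ∈ level w (X.baseChange K) (w (p : K))) :
    WeierstrassCurve.Affine.Point.map ι Q ∈ level w' (X.baseChange K') (w' (p : K')) := by
  refine ⟨(map_mem_kernel_iff_of_val_eq hι Q).mpr hQ.1, ?_⟩
  rw [zCoord_map, hι, ← map_natCast ι p, hι]
  exact hQ.2

/-- **Base change of the limit logarithm**: for an isometric `E`-algebra map `ι : K → K'` and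
(SPEC)-logarithms `ℓ` on `E⁽ᵖ⁾(X_K)`, `ℓ'` on `E⁽ᵖ⁾(X_{K'})`: `ℓ'(ι Q) = ι(ℓ Q)` for `Q ∈ E⁽ᵖ⁾(X_K)`
(both sides are `|p|`-adic limits of `z(pʳ·ιQ)/pʳ = ι(z(pʳ·Q)/pʳ)`).
[cite: SilvermanAEC2009, Thm. IV.6.4 with Prop. VII.2.2] -/
theorem limitLog_map_of_val_eq {p : ℕ} (hp1 : w' (p : K') < 1)
    {ℓ : (X.baseChange K).toAffine.Point → K}
    {ℓ' : (X.baseChange K').toAffine.Point → K'}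
    (hℓ : ∀ Q ∈ level w (X.baseChange K) (w (p : K)), ∀ r : ℕ,
      w (ℓ Q - ((p ^ r) • Q).zCoord / (p : K) ^ r) ≤ w (p : K) ^ (r + 1))
    (hℓ' : ∀ Q ∈ level w' (X.baseChange K') (w' (p : K')), ∀ r : ℕ,
      w' (ℓ' Q - ((p ^ r) • Q).zCoord / (p : K') ^ r) ≤ w' (p : K') ^ (r + 1))
    {ι : K →ₐ[E] K'} (hι : ∀ x, w' (ι x) = w x)
    {Q : (X.baseChange K).toAffine.Point} (hQ : Q ∈ level w (X.baseChange K) (w (p : K))) :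
    ℓ' (WeierstrassCurve.Affine.Point.map ι Q) = ι (ℓ Q) := by
  refine limitLog_eq_of_forall_val_sub_approx_le hp1 hℓ' (map_mem_level_of_val_eq hι hQ) fun r ↦ ?_
  have e : ι (ℓ Q) - ((p ^ r) • WeierstrassCurve.Affine.Point.map ι Q).zCoord / (p : K') ^ r =
      ι (ℓ Q - ((p ^ r) • Q).zCoord / (p : K) ^ r) := by
    rw [← map_nsmul, zCoord_map, map_sub, map_div₀, map_pow, map_natCast]
  have hp' : w' (p : K') = w (p : K) := by rw [← map_natCast ι p, hι]
  rw [e, hι, hp']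
  exact hℓ Q hQ r

end BaseChange

/-! ### The `ℚ_p` case -/

section Padic

variable {p : ℕ} [Fact p.Prime] (X : WeierstrassCurve ℚ_[p])

/-- A `p`-integral Weierstrass equation over `ℚ_p` (coefficients in `ℤ_p`, Silverman *AEC* VII.1:
"a Weierstrass equation with coefficients in `R = {x ∈ K : v(x) ≥ 0}`") is integral for the
valuation ring of `NormedField.valuation = ‖·‖₊` (the closed unit ball `{‖x‖ ≤ 1} = ℤ_p`): the two
renderings of "integral equation" in the tree (`X.IsIntegral ℤ_[p]` of `FormalGroup.lean` /
`PadicPointsFiltration*` and `V.IsIntegral w.integer` of `FormalGroupChart`) agree.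
[cite: SilvermanAEC2009, VII.1 (Weierstrass equations with coefficients in R, PDF p. 165)] -/
theorem isIntegral_valuationInteger_of_isIntegral_padicInt [hX : X.IsIntegral ℤ_[p]] :
    X.IsIntegral (NormedField.valuation (K := ℚ_[p])).integer := by
  obtain ⟨X₀, hX₀⟩ := hX.integral
  have hmem : ∀ a : ℤ_[p], (a : ℚ_[p]) ∈ (NormedField.valuation (K := ℚ_[p])).integer := fun a ↦ by
    change NormedField.valuation (a : ℚ_[p]) ≤ 1
    rw [NormedField.valuation_apply, ← NNReal.coe_le_coe, coe_nnnorm, NNReal.coe_one]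
    exact a.2
  refine WeierstrassCurve.isIntegral_of_exists_lift _ ⟨⟨(X₀.a₁ : ℚ_[p]), hmem _⟩, ?_⟩
    ⟨⟨(X₀.a₂ : ℚ_[p]), hmem _⟩, ?_⟩
    ⟨⟨(X₀.a₃ : ℚ_[p]), hmem _⟩, ?_⟩ ⟨⟨(X₀.a₄ : ℚ_[p]), hmem _⟩, ?_⟩ ⟨⟨(X₀.a₆ : ℚ_[p]), hmem _⟩, ?_⟩
  all_goals rw [hX₀]; rfl

/-- The two renderings of the parameter agree: `Affine.Point.zCoord = WeierstrassCurve.formalParameter`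
(both are `z(O) = 0`, `z(x, y) = -x/y`). [cite: SilvermanAEC2009, Prop. VII.2.2] -/
theorem zCoord_eq_formalParameter (P : X.toAffine.Point) : P.zCoord = X.formalParameter P := by
  rcases P with _ | ⟨x, y, h⟩ <;> rfl

variable [hV : X.IsIntegral (NormedField.valuation (K := ℚ_[p])).integer]

/-- The two renderings of `E₁(ℚ_p)` agree: `FormalGroupChart.kernel ‖·‖₊ X` (file
`FormalGroupChart`) and `WeierstrassCurve.IsInReductionKernel` (file `FormalGroup`).
[cite: SilvermanAEC2009, Prop. VII.2.2] -/
theorem mem_kernel_iff_isInReductionKernel (P : X.toAffine.Point) :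
    P ∈ kernel NormedField.valuation X ↔ X.IsInReductionKernel P := by
  rcases P with _ | ⟨x, y, h⟩
  · exact ⟨fun _ ↦ X.isInReductionKernel_zero, fun _ ↦ (kernel NormedField.valuation X).zero_mem⟩
  · rw [some_mem_kernel_iff]
    change (‖x‖₊ : ℝ≥0) > 1 ↔ 1 < ‖x‖
    rw [gt_iff_lt, ← NNReal.coe_lt_coe, coe_nnnorm, NNReal.coe_one]

/-- **`ℚ_p` is unramified**: `‖x‖ < 1 ⇒ ‖x‖ ≤ ‖p‖ = p⁻¹` (the value group is `p^ℤ`).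
[folklore] -/
private theorem padic_hdisc (x : ℚ_[p]) (hx : NormedField.valuation x < 1) :
    NormedField.valuation x ≤ NormedField.valuation (p : ℚ_[p]) := by
  rw [NormedField.valuation_apply, NormedField.valuation_apply, ← NNReal.coe_le_coe, coe_nnnorm,
    coe_nnnorm, Padic.norm_p]
  rw [NormedField.valuation_apply, ← NNReal.coe_lt_coe, coe_nnnorm, NNReal.coe_one] at hx
  have h := (Padic.norm_le_pow_iff_norm_lt_pow_add_one x (-1)).mpr (by
    rw [show (-1 : ℤ) + 1 = 0 by norm_num, zpow_zero]; exact hx)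
  rwa [zpow_neg, zpow_one] at h

/-- `0 < ‖p‖ < 1` in `ℚ_p`, in the valuation language. [folklore] -/
private theorem padic_natCast_ne_zero_and_val_lt_one :
    ((p : ℚ_[p]) ≠ 0) ∧ NormedField.valuation (p : ℚ_[p]) < 1 := by
  refine ⟨Nat.cast_ne_zero.mpr (Fact.out : p.Prime).ne_zero, ?_⟩
  rw [NormedField.valuation_apply, ← NNReal.coe_lt_coe, coe_nnnorm, NNReal.coe_one, Padic.norm_p]
  exact inv_lt_one_of_one_lt₀ (by exact_mod_cast (Fact.out : p.Prime).one_lt)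

/-- **Over `ℚ_p` the level `E⁽ᵖ⁾` is the whole kernel of reduction `E₁(ℚ_p)`** (`ℚ_p` is
unramified). [cite: SilvermanAEC2009, Thm. IV.6.4(b)] -/
theorem level_padic_eq_kernel :
    level NormedField.valuation X (NormedField.valuation (p : ℚ_[p])) =
      kernel NormedField.valuation X :=
  level_val_natCast_eq_kernel (padic_hdisc (p := p))

/-- **A (SPEC)-logarithm on all of `E₁(ℚ_p)`**: there is `ℓ : E(ℚ_p) → ℚ_p` with
`‖ℓ(Q) − z(pʳ·Q)/pʳ‖ ≤ p^{−(r+1)}` for every `Q ∈ E₁(ℚ_p)` and every `r`; all theorems of parts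
I–III apply to it (integrality `ℓ(E₁(ℚ_p)) ⊆ pℤ_p`, additivity, …).
[cite: SilvermanAEC2009, Thm. IV.6.4 with Prop. VII.2.2] -/
theorem exists_limitLog_padic :
    ∃ ℓ : X.toAffine.Point → ℚ_[p], ∀ Q ∈ kernel NormedField.valuation X, ∀ r : ℕ,
      NormedField.valuation (ℓ Q - ((p ^ r) • Q).zCoord / (p : ℚ_[p]) ^ r) ≤
        NormedField.valuation (p : ℚ_[p]) ^ (r + 1) := by
  obtain ⟨hp0, hp1⟩ := padic_natCast_ne_zero_and_val_lt_one (p := p)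
  obtain ⟨ℓ, hℓ⟩ := exists_limitLog_of_completeSpace (V := X) hp0 hp1
  refine ⟨ℓ, fun Q hQ ↦ hℓ Q ?_⟩
  rwa [level_padic_eq_kernel]

/-- Tail estimate for a `ρ`-geometric Cauchy sequence converging to `y`: `|y − x_r| ≤ ρ^{r+1}`.
[folklore] -/
private theorem val_sub_le_pow_of_tendsto {ρ : ℝ≥0} (hρ1 : ρ < 1) {x : ℕ → ℚ_[p]} {y : ℚ_[p]}
    (hx : ∀ r, NormedField.valuation (x (r + 1) - x r) ≤ ρ ^ (r + 1))
    (hy : Filter.Tendsto x Filter.atTop (nhds y)) (r : ℕ) :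
    NormedField.valuation (y - x r) ≤ ρ ^ (r + 1) := by
  have hx' : ∀ r, ‖x (r + 1) - x r‖ ≤ (ρ : ℝ) ^ (r + 1) := fun r ↦ by
    have h := hx r
    rw [NormedField.valuation_apply, ← NNReal.coe_le_coe, coe_nnnorm, NNReal.coe_pow] at h
    exact h
  have hρ1' : (ρ : ℝ) < 1 := by exact_mod_cast hρ1
  have htel : ∀ k, ‖x (k + r) - x r‖ ≤ (ρ : ℝ) ^ (r + 1) := by
    intro k
    induction k with
    | zero => simp only [zero_add, sub_self, norm_zero]; positivity
    | succ k ih =>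
      have h1 : ‖x (k + r + 1) - x (k + r)‖ ≤ (ρ : ℝ) ^ (r + 1) :=
        (hx' (k + r)).trans (pow_le_pow_of_le_one (NNReal.coe_nonneg ρ) hρ1'.le (by omega))
      have ek : k + 1 + r = k + r + 1 := by omega
      calc ‖x (k + 1 + r) - x r‖ = dist (x (k + r + 1)) (x r) := by rw [dist_eq_norm, ek]
        _ ≤ max (dist (x (k + r + 1)) (x (k + r))) (dist (x (k + r)) (x r)) :=
            dist_triangle_max _ _ _
        _ ≤ (ρ : ℝ) ^ (r + 1) := by
            rw [dist_eq_norm, dist_eq_norm]; exact max_le h1 ih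
  have hlim : Filter.Tendsto (fun k ↦ ‖x (k + r) - x r‖) Filter.atTop (nhds ‖y - x r‖) :=
    (((Filter.tendsto_add_atTop_iff_nat r).mpr hy).sub_const (x r)).norm
  have hle : ‖y - x r‖ ≤ (ρ : ℝ) ^ (r + 1) := le_of_tendsto' hlim fun k ↦ htel k
  rw [NormedField.valuation_apply, ← NNReal.coe_le_coe, coe_nnnorm, NNReal.coe_pow]
  exact hle

variable {X}

/-- **`ℓ = padicLimitLog` where the tree's limit logarithm is known to converge**: for an
elliptic `p`-integral `X`, any (SPEC)-logarithm `ℓ` on `E₁(ℚ_p)` and `Q ∈ E₁(ℚ_p)` with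
`‖z(Q)‖ < p⁻¹`, `ℓ(Q) = X.padicLimitLog Q` (the tree's `tendsto_approx_padicLimitLog` gives the
limit of the same sequence `z(pᵏ·Q)/pᵏ`). [cite: SilvermanAEC2009, Thm. IV.6.4(b) and Prop. VII.6.3] -/
theorem limitLog_eq_padicLimitLog [X.IsIntegral ℤ_[p]] [X.IsElliptic]
    {ℓ : X.toAffine.Point → ℚ_[p]}
    (hℓ : ∀ Q ∈ kernel NormedField.valuation X, ∀ r : ℕ,
      NormedField.valuation (ℓ Q - ((p ^ r) • Q).zCoord / (p : ℚ_[p]) ^ r) ≤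
        NormedField.valuation (p : ℚ_[p]) ^ (r + 1))
    {Q : X.toAffine.Point} (hQ : Q ∈ kernel NormedField.valuation X)
    (hr : ‖X.formalParameter Q‖ < (p : ℝ)⁻¹) : ℓ Q = X.padicLimitLog Q := by
  obtain ⟨hp0, hp1⟩ := padic_natCast_ne_zero_and_val_lt_one (p := p)
  have hQ' : X.IsInReductionKernel Q := (mem_kernel_iff_isInReductionKernel X Q).mp hQ
  have hQl : Q ∈ level NormedField.valuation X (NormedField.valuation (p : ℚ_[p])) := by
    rw [level_padic_eq_kernel]; exact hQ
  have hℓ' : ∀ Q ∈ level NormedField.valuation X (NormedField.valuation (p : ℚ_[p])), ∀ r : ℕ,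
      NormedField.valuation (ℓ Q - ((p ^ r) • Q).zCoord / (p : ℚ_[p]) ^ r) ≤
        NormedField.valuation (p : ℚ_[p]) ^ (r + 1) := fun Q hQ ↦ hℓ Q (by
    rwa [level_padic_eq_kernel] at hQ)
  refine limitLog_eq_of_forall_val_sub_approx_le hp1 hℓ' hQl ?_
  -- the tree's sequence is ours (`zCoord = formalParameter`), and it tends to `padicLimitLog Q`
  have ht := X.tendsto_approx_padicLimitLog hQ' hr
  have hseq : (fun k : ℕ ↦ X.formalParameter ((p ^ k : ℕ) • Q) / (p : ℚ_[p]) ^ k) =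
      fun k : ℕ ↦ ((p ^ k) • Q).zCoord / (p : ℚ_[p]) ^ k := by
    funext k; rw [zCoord_eq_formalParameter]
  rw [hseq] at ht
  exact val_sub_le_pow_of_tendsto hp1 (fun r ↦ val_approx_succ_sub_le_pow hQl.1 hp0 hQl.2 r) ht

/-- **`ℓ(Q) = padicLimitLog (p·Q) / p` on ALL of `E₁(ℚ_p)`**: `p·Q` lies in the domain
`‖z‖ < p⁻¹` of the tree's limit logarithm (`‖z(p·Q)‖ ≤ p⁻¹‖z(Q)‖ < p⁻¹`), and `ℓ(p·Q) = p·ℓ(Q)`.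
This is the bridge through which the `ℚ_p`-statements of the tree phrased with `padicLimitLog`
(and `padicLog = padicLimitLog(N·)/N`) apply to `ℓ`. [cite: SilvermanAEC2009, Thm. IV.6.4 and Prop. VII.6.3] -/
theorem limitLog_eq_padicLimitLog_smul_div [X.IsIntegral ℤ_[p]] [X.IsElliptic]
    {ℓ : X.toAffine.Point → ℚ_[p]}
    (hℓ : ∀ Q ∈ kernel NormedField.valuation X, ∀ r : ℕ,
      NormedField.valuation (ℓ Q - ((p ^ r) • Q).zCoord / (p : ℚ_[p]) ^ r) ≤
        NormedField.valuation (p : ℚ_[p]) ^ (r + 1))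
    {Q : X.toAffine.Point} (hQ : Q ∈ kernel NormedField.valuation X) :
    ℓ Q = X.padicLimitLog (p • Q) / (p : ℚ_[p]) := by
  obtain ⟨hp0, hp1⟩ := padic_natCast_ne_zero_and_val_lt_one (p := p)
  have hℓ' : ∀ Q ∈ level NormedField.valuation X (NormedField.valuation (p : ℚ_[p])), ∀ r : ℕ,
      NormedField.valuation (ℓ Q - ((p ^ r) • Q).zCoord / (p : ℚ_[p]) ^ r) ≤
        NormedField.valuation (p : ℚ_[p]) ^ (r + 1) := fun Q hQ ↦ hℓ Q (by
    rwa [level_padic_eq_kernel] at hQ)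
  have hQl : Q ∈ level NormedField.valuation X (NormedField.valuation (p : ℚ_[p])) := by
    rw [level_padic_eq_kernel]; exact hQ
  have hpQ : p • Q ∈ kernel NormedField.valuation X := (kernel NormedField.valuation X).nsmul_mem hQ p
  -- `‖z(p·Q)‖ < p⁻¹`
  have hz : NormedField.valuation (p • Q).zCoord ≤
      NormedField.valuation (p : ℚ_[p]) * NormedField.valuation Q.zCoord :=
    val_zCoord_natCast_smul_le hQl.1 hQl.2
  have hlt1 : NormedField.valuation Q.zCoord < 1 := val_zCoord_lt_one hQl.1
  have hr : ‖X.formalParameter (p • Q)‖ < (p : ℝ)⁻¹ := by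
    rw [← zCoord_eq_formalParameter, ← coe_nnnorm, ← NormedField.valuation_apply, ← Padic.norm_p,
      ← coe_nnnorm (p : ℚ_[p]), ← NormedField.valuation_apply]
    have hp' : 0 < NormedField.valuation (p : ℚ_[p]) := (Valuation.pos_iff _).mpr hp0
    calc ((NormedField.valuation (p • Q).zCoord : ℝ≥0) : ℝ)
        ≤ ((NormedField.valuation (p : ℚ_[p]) * NormedField.valuation Q.zCoord : ℝ≥0) : ℝ) := by
          exact_mod_cast hz
      _ < ((NormedField.valuation (p : ℚ_[p]) * 1 : ℝ≥0) : ℝ) := by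
          exact_mod_cast mul_lt_mul_of_pos_left hlt1 hp'
      _ = ((NormedField.valuation (p : ℚ_[p]) : ℝ≥0) : ℝ) := by rw [mul_one]
  rw [← limitLog_eq_padicLimitLog hℓ hpQ hr, limitLog_nsmul hp0 hp1 hℓ' hQl p,
    mul_div_cancel_left₀ _ hp0]

end Padic

end Literature.NumberTheory.EllipticCurves.FormalGroupChart

end
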